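import Summits.QuantumFields.YangMills.Theorems.BalabanUVNodesN15CovariantLandauOnePropagatorKnitDefectRowTf
import Summits.QuantumFields.YangMills.Theorems.BalabanUVNodesN15TwoSpacingGluingCurvedKnitCovariantLandauNodeEntries
import HarnessLib

/-!
# Route «BalabanUVNodes», node N15 = NE2, road (c) — PROGRAMME (P-S), LI: ★★★★ `Live ∧ N15At` FOR THE ROAD-(c) LITERAL WITH BAŁABAN's WHOLE COVARIANT SUMMAND LIVE IN THE ONE PROPAGATOR,
# ALL FOUR OPERATOR ENTRIES CONCRETE, AND **NO DISPLAYED ROW** — dag-n15-a's (♭-8b)∕(♭-8c) `…_of_defectRow` ∕ `…_tf` faces with their one displayed hypothesis `hD` DISCHARGED by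
# n15-c∕257 `landauDefectRow_sfqr`; the trace-form edition has PURELY NUMERIC hypotheses (`d ≥ 1`, odd `L ≥ 7`, `a, c₃₅ > 0`) (dag-n15-c g25, n15-c∕258)

Cell `pub-ymgap`, seat `pub-ymgap-dag-n15-c` (generation g25; R134 (a), s1; HUMAN RULING D-0062; chair R424 venue).  `bears_on: R4∕N15 · K3⁸ SpineGivenEndpointR13SepCoPHV
(stmt-QuantumFields-27366)`; filed `--supports stmt-QuantumFields-27366 --as helper` — COUNT-NEUTRAL.  One plumbing `def` (`wQ8c`, the pinned threshold) + six one-line theorems; 0 `sorry`.  Plumbing `def` ⇒ review ∕ audit lane.  Nothing in the tree is modified.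

WHAT THIS FILE PROVES (kernel).  dag-n15-a g33 built the whole road-(c) superstructure of the (P-R) one-propagator literal `sfObjects₈qvr` — OPERATOR layer (R8a) `ne2PlusOperator_sfqr₄E` (all four
entries of (3.42) concrete: `sfqrE₄`), SITE and UNIT layers, GUARD, keyed face — MODULO the two-grid η-defect row `hD` of the Landau letter `N_V^R` ((♭-8a)∕(♭-8b)∕(♭-8c): `…_of_defectRow`,
`…_wQ8D`, `…_tf`).  n15-c∕257 `Gluing.landauDefectRow_sfqr d mm ι e hL hL7 ha hc35` PROVES `hD` literally (every index, every class field, one constant block).  Composing: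
(1) ★★★★ `exists_live_and_n15At_sfObjects₈qvr_closed`: `∃ w, Live (ne2OfRecord₁₁ (sfObjects₈qvr … w)) ∧ N15At (ne2OfRecord₁₁ (sfObjects₈qvr … w))` from `d ≥ 1`, odd `L ≥ 7`, `a, c₃₅ > 0` and the
trace-form coordinates `he` ONLY; (2) def `wQ8c` := dag-n15-a's `wQ8D` at `hD := landauDefectRow_sfqr …` and ★★★ `live_and_n15At_sfObjects₈qvr_wQ8c`: the same at the pinned threshold; (3) ★★ the keyed face
`s_N15_of_admits_sf₈qvr_closed` (part 30's interface: `S_N15 RRec` for any rate home admitting only this literal); (4) ★★★ `ne2PlusOperator_sfqr₄E_closed_tf` (the operator layer), (5) ★★★★ `exists_live_and_n15At_sfObjects₈qvr_tf_closed` and (6) ★★★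
`live_and_n15At_sfObjects₈qvr_wQ8c_tf`: the trace-form coordinates `e := tfCoords mm`, `ι := Fin 2 × mm × mm` supplied — PURELY NUMERIC HYPOTHESES `1 ≤ d`, `Odd L ∧ 1 < L`, `7 ≤ L`,
`0 < a`, `0 < c35` (plus the free direction ∕ colour ∕ momentum parameters of the literal).

HONEST FRAMING ∕ LIMITS.  Everything displayed by dag-n15-a's (♭-8b)∕(♭-8c) is now a theorem; what the literal MEANS is unchanged and stays MODEL level: MODEL carriers ∕ operators (doubled
torus `2L^{m+1}` per index, `L ≥ 7`, global small-field gauge `U′ = e^{A′∕n′}`, `U = e^{Ā∕n}` with King block means, one averaging level, unit weights, site transporters `cvT₀`, `Q(U)` = the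
main term (125) of [B7] (124), King-block-mean pairing, `Reg336` idle, covariant forward gradients in FILE 144's model sense, crude constants, `Classical.choose` thresholds); the η-rate
inequalities are quantifier TEMPLATES — NOT [Balaban1985BackgroundPropagators] Thms 3.1 ∕ 3.2 ∕ 3.4 ∕ 3.14 ∕ 3.15 AS PRINTED; NE2⁺ is NOT a printed statement.  Behind `landauDefectRow_sfqr`:
King's `A = 0` MODEL kernel theorems (n15-c∕220, dag-n15-a Ξ-1…Ξ-6), the cell's Combes–Thomas row (n15-c∕222b), n15-c's Leibniz route 212–256.  N15 stays DISCHARGED OF RECORD 8∕27 AS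
CONSUMED (U-blind v7 pin, p687738) — no re-pin asked, nothing re-claimed, no count moved; K3⁸ OPEN; one finite 𝕋⁴ at fixed ε per index — NOT ℝ⁴ ∕ infinite volume ∕ OS ∕ mass gap ∕ Clay.
-/

noncomputable section

open scoped BigOperators Matrix

namespace Summit.QuantumFields.YangMills.BalabanUVNodes.N15.SiteLayerSf

open Literature.MathematicalPhysics.QuantumFieldTheory.Balaban1983to89
open Literature.MathematicalPhysics.QuantumFieldTheory.Balaban1983to89.T4EtaRate (NE2PlusOperator)
open Literature.Barriers.QuantumFields (traceForm)
open Summit.QuantumFields.YangMills.BalabanUVNodes.N15.Gluing (SfIdx sfInstance sfqrFamily sfqrE₄ landauDefectRow_sfqr ne2PlusOperator_sfqr₄E_closed)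
open Summit.QuantumFields.YangMills.BalabanUVNodes.N15.PairedFamilyGuard (Live)
open Literature.MathematicalPhysics.QuantumFieldTheory.Balaban1983to89.T4Continuum (T4Family ULoop)
open Node00 (NE2Objects₁₁)
open Summit.QuantumFields.YangMills.BalabanUVNodes.N15.AtKeyedHome (s_N15_of_admits)
open YMDAG.UVSplit (Datum RateCarriers RateRecordPred N15At S_N15 ne2OfRecord₁₁)

open scoped Matrix.Norms.L2Operator

variable (d : ℕ) {L : ℕ} [NeZero L] (mm ι : Type) [Fintype mm] [DecidableEq mm] [Nonempty mm] [Fintype ι] [DecidableEq ι] (a : ℝ) (e : Matrix mm mm ℂ ≃L[ℝ] (ι → ℝ))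

section Closed

/-- ★★★★ **GUARD ∧ `N15At` AT THE (P-R) ONE-PROPAGATOR LITERAL, SOME THRESHOLD, ALL FOUR OPERATOR ENTRIES CONCRETE, NO DISPLAYED ROW**: for `d ≥ 1`, odd `L ≥ 7`, `a, c₃₅ > 0` and trace-form
coordinates `e`, SOME threshold `w` makes the literal `sfObjects₈qvr` — Bałaban's WHOLE covariant summand `a·Q*(U)Q(U) − D_U(I − R(U))D*_U` live in the ONE propagator of (3.42), (3.48) and
(3.187), all four operator entries concrete — satisfy `Live ∧ N15At` ((♭-8b) `exists_live_and_n15At_sfObjects₈qvr_of_defectRow` ∘ n15-c∕257 `landauDefectRow_sfqr`).  MODEL carriers; NOT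
[Balaban1985BackgroundPropagators] as printed. [cite: Balaban1985BackgroundPropagators, Thm 3.1 (3.42) p.397, Thm 3.2 (3.47)–(3.48) p.398, Thm 3.15 (3.187) p.432 (templates: MODEL level), (3.49) p.399] -/
theorem exists_live_and_n15At_sfObjects₈qvr_closed [Nonempty ι] (hd : 1 ≤ d) (hL : Odd L ∧ 1 < L) (hL7 : 7 ≤ L) (ha : 0 < a) {c35 : ℝ} (hc35 : 0 < c35)
    (he : ∀ A B : Matrix mm mm ℂ, traceForm A B = e A ⬝ᵥ e B) (μ₁ μ₂ : Fin (d + 1)) (α β : Fin (d + 1)) (j j' : ι) (α' β' : Fin (d + 1)) (j₂ j₂' : ι) (p : ℝ) :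
    ∃ w : ℝ, Live (ne2OfRecord₁₁ (sfObjects₈qvr d mm ι a e hL μ₁ μ₂ α β j j' α' β' j₂ j₂' c35 p w)) ∧
      N15At (ne2OfRecord₁₁ (sfObjects₈qvr d mm ι a e hL μ₁ μ₂ α β j j' α' β' j₂ j₂' c35 p w)) :=
  exists_live_and_n15At_sfObjects₈qvr_of_defectRow d mm ι a e hd hL hL7 ha hc35 he μ₁ μ₂ (landauDefectRow_sfqr d mm ι e hL hL7 ha hc35) α β j j' α' β' j₂ j₂' p

/-- **THE PINNED THRESHOLD** `w_Q8c` of the closed (P-R) four-entries literal: dag-n15-a's `wQ8D` (a `Classical.choose`; the cube floor is NOT explicit) at `hD := landauDefectRow_sfqr …`.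
[bookkeeping] -/
def wQ8c [Nonempty ι] (hd : 1 ≤ d) (hL : Odd L ∧ 1 < L) (hL7 : 7 ≤ L) (ha : 0 < a) {c35 : ℝ} (hc35 : 0 < c35) (he : ∀ A B : Matrix mm mm ℂ, traceForm A B = e A ⬝ᵥ e B)
    (μ₁ μ₂ : Fin (d + 1)) (α β : Fin (d + 1)) (j j' : ι) (α' β' : Fin (d + 1)) (j₂ j₂' : ι) (p : ℝ) : ℝ :=
  wQ8D d mm ι a e hd hL hL7 ha hc35 he μ₁ μ₂ (landauDefectRow_sfqr d mm ι e hL hL7 ha hc35) α β j j' α' β' j₂ j₂' p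

/-- ★★★ **GUARD ∧ `N15At` AT THE CLOSED (P-R) ONE-PROPAGATOR LITERAL PINNED AT `w_Q8c`, NO DISPLAYED ROW** ((♭-8b) `live_and_n15At_sfObjects₈qvr_wQ8D` with `hD := landauDefectRow_sfqr …`):
ONE model propagator `G(U) = X_r` with Bałaban's WHOLE covariant summand live, read by (3.42), (3.48) and (3.187) alike, all four operator entries concrete; hypotheses `d ≥ 1`, odd `L ≥ 7`,
`a, c₃₅ > 0`, `he`.  MODEL carriers; NOT [Balaban1985BackgroundPropagators] as printed. [cite: Balaban1985BackgroundPropagators, (3.42) p.397, Thms 3.1∕3.2 p.398, Thm 3.15 p.432 (templates: MODEL level)] -/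
theorem live_and_n15At_sfObjects₈qvr_wQ8c [Nonempty ι] (hd : 1 ≤ d) (hL : Odd L ∧ 1 < L) (hL7 : 7 ≤ L) (ha : 0 < a) {c35 : ℝ} (hc35 : 0 < c35)
    (he : ∀ A B : Matrix mm mm ℂ, traceForm A B = e A ⬝ᵥ e B) (μ₁ μ₂ : Fin (d + 1)) (α β : Fin (d + 1)) (j j' : ι) (α' β' : Fin (d + 1)) (j₂ j₂' : ι) (p : ℝ) :
    Live (ne2OfRecord₁₁ (sfObjects₈qvr d mm ι a e hL μ₁ μ₂ α β j j' α' β' j₂ j₂' c35 p (wQ8c d mm ι a e hd hL hL7 ha hc35 he μ₁ μ₂ α β j j' α' β' j₂ j₂' p))) ∧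
      N15At (ne2OfRecord₁₁ (sfObjects₈qvr d mm ι a e hL μ₁ μ₂ α β j j' α' β' j₂ j₂' c35 p (wQ8c d mm ι a e hd hL hL7 ha hc35 he μ₁ μ₂ α β j j' α' β' j₂ j₂' p))) :=
  live_and_n15At_sfObjects₈qvr_wQ8D d mm ι a e hd hL hL7 ha hc35 he μ₁ μ₂ (landauDefectRow_sfqr d mm ι e hL hL7 ha hc35) α β j j' α' β' j₂ j₂' p

variable {N : ℕ} [NeZero N] {key : (F : T4Family) → Datum F N → Prop}

/-- ★★ **THE CLOSED (P-R) FOUR-ENTRIES LITERAL (pinned at `w_Q8c`) AT ANY KEYED HOME, NO DISPLAYED ROW** ((♭-8b) `s_N15_of_admits_sf₈qvr_defect` with `hD` supplied; part 30's interface: `ne2At` a BINDER, `hadm` and the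
value equation `h` hypotheses — no pin, no v8). [bookkeeping] -/
theorem s_N15_of_admits_sf₈qvr_closed [Nonempty ι] (hd : 1 ≤ d) (hL : Odd L ∧ 1 < L) (hL7 : 7 ≤ L) (ha : 0 < a) {c35 : ℝ} (hc35 : 0 < c35)
    (he : ∀ A B : Matrix mm mm ℂ, traceForm A B = e A ⬝ᵥ e B) (μ₁ μ₂ : Fin (d + 1)) (α β : Fin (d + 1)) (j j' : ι) (α' β' : Fin (d + 1)) (j₂ j₂' : ι) (p : ℝ)
    (ne2At : ∀ {F : T4Family} {D : Datum F N}, key F D → (ℕ → ℝ) → List (ULoop F) → ℕ → NE2Objects₁₁) (RRec : RateRecordPred N)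
    (hadm : ∀ (F : T4Family) (D : Datum F N) (g₀ : ℕ → ℝ) (os : List (ULoop F)) (R : RateCarriers N), RRec F D g₀ os R →
      ∃ (h : key F D) (k : ℕ), R.ne2 = ne2OfRecord₁₁ (ne2At h g₀ os k))
    (h : ∀ (F : T4Family) (D : Datum F N) (h : key F D) (g₀ : ℕ → ℝ) (os : List (ULoop F)) (k : ℕ),
      ne2At h g₀ os k = sfObjects₈qvr d mm ι a e hL μ₁ μ₂ α β j j' α' β' j₂ j₂' c35 p (wQ8c d mm ι a e hd hL hL7 ha hc35 he μ₁ μ₂ α β j j' α' β' j₂ j₂' p)) :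
    S_N15 RRec :=
  s_N15_of_admits_sf₈qvr_defect d mm ι a e hd hL hL7 ha hc35 he μ₁ μ₂ (landauDefectRow_sfqr d mm ι e hL hL7 ha hc35) α β j j' α' β' j₂ j₂' p ne2At RRec hadm h

end Closed

section Tf

/-- ★★★ **THE OPERATOR LAYER ON NUMERIC HYPOTHESES**: n15-c∕257 `ne2PlusOperator_sfqr₄E_closed` at the trace-form coordinates (`e := tfCoords mm`, `ι := Fin 2 × mm × mm`; dag-n15-a (T-1)
`traceForm_eq_tfCoords_dotProduct` discharges `he`) — `NE2PlusOperator` for the (P-R) knit family, all four entries concrete, from `Odd L ∧ 1 < L`, `7 ≤ L`, `0 < a`, `0 < c35` alone.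
MODEL carriers; NOT [Balaban1985BackgroundPropagators] Thm 3.1 ∕ 3.14 as printed. [cite: Balaban1985BackgroundPropagators, Thm 3.1 (3.42) p.397, Thm 3.14 pp.426–427 (templates: MODEL level)] -/
theorem ne2PlusOperator_sfqr₄E_closed_tf (hL : Odd L ∧ 1 < L) (hL7 : 7 ≤ L) (ha : 0 < a) {c35 : ℝ} (hc35 : 0 < c35) (μ₁ μ₂ : Fin (d + 1)) :
    NE2PlusOperator c35 (sfInstance d mm (Fin 2 × mm × mm) hL)
      (fun i => sfqrFamily d mm (Fin 2 × mm × mm) a (TraceFormCoords.tfCoords mm) hL i (sfqrE₄ d mm (Fin 2 × mm × mm) (TraceFormCoords.tfCoords mm) hL a μ₁ μ₂ i)) :=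
  ne2PlusOperator_sfqr₄E_closed d mm (Fin 2 × mm × mm) (TraceFormCoords.tfCoords mm) hL hL7 ha hc35 (TraceFormCoords.traceForm_eq_tfCoords_dotProduct mm) μ₁ μ₂

/-- ★★★★ **PURELY NUMERIC HYPOTHESES**: for `d ≥ 1`, odd `L ≥ 7`, `a, c₃₅ > 0` (and the free directions `μ₁ μ₂ α β α′ β′`, colours `j j′ j₂ j₂′`, momentum `p` of the literal), SOME threshold `w`
makes the (P-R) one-propagator literal at the trace-form coordinates (`e := tfCoords mm`, `ι := Fin 2 × mm × mm`) satisfy `Live ∧ N15At` — (♭-8c) `exists_live_and_n15At_sfObjects₈qvr_tf` ∘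
n15-c∕257 `landauDefectRow_sfqr`.  MODEL carriers; NOT [Balaban1985BackgroundPropagators] as printed; N15 of record untouched.
[cite: Balaban1985BackgroundPropagators, Thm 3.1 (3.42) p.397, Thm 3.2 (3.47)–(3.48) p.398, Thm 3.15 (3.187) p.432 (templates: MODEL level), (3.35)–(3.37) p.396, (3.49) p.399] -/
theorem exists_live_and_n15At_sfObjects₈qvr_tf_closed (hd : 1 ≤ d) (hL : Odd L ∧ 1 < L) (hL7 : 7 ≤ L) (ha : 0 < a) {c35 : ℝ} (hc35 : 0 < c35) (μ₁ μ₂ : Fin (d + 1))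
    (α β : Fin (d + 1)) (j j' : Fin 2 × mm × mm) (α' β' : Fin (d + 1)) (j₂ j₂' : Fin 2 × mm × mm) (p : ℝ) :
    ∃ w : ℝ, Live (ne2OfRecord₁₁ (sfObjects₈qvr d mm (Fin 2 × mm × mm) a (TraceFormCoords.tfCoords mm) hL μ₁ μ₂ α β j j' α' β' j₂ j₂' c35 p w)) ∧
      N15At (ne2OfRecord₁₁ (sfObjects₈qvr d mm (Fin 2 × mm × mm) a (TraceFormCoords.tfCoords mm) hL μ₁ μ₂ α β j j' α' β' j₂ j₂' c35 p w)) :=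
  exists_live_and_n15At_sfObjects₈qvr_tf d mm a hd hL hL7 ha hc35 μ₁ μ₂
    (landauDefectRow_sfqr d mm (Fin 2 × mm × mm) (TraceFormCoords.tfCoords mm) hL hL7 ha hc35) α β j j' α' β' j₂ j₂' p

/-- ★★★ **THE SAME AT THE PINNED THRESHOLD `w_Q8c`, TRACE-FORM COORDINATES SUPPLIED** ((♭-8c) `live_and_n15At_sfObjects₈qvr_wQ8D_tf` with `hD := landauDefectRow_sfqr …`): purely numeric
hypotheses. [bookkeeping] -/
theorem live_and_n15At_sfObjects₈qvr_wQ8c_tf (hd : 1 ≤ d) (hL : Odd L ∧ 1 < L) (hL7 : 7 ≤ L) (ha : 0 < a) {c35 : ℝ} (hc35 : 0 < c35) (μ₁ μ₂ : Fin (d + 1))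
    (α β : Fin (d + 1)) (j j' : Fin 2 × mm × mm) (α' β' : Fin (d + 1)) (j₂ j₂' : Fin 2 × mm × mm) (p : ℝ) :
    Live (ne2OfRecord₁₁ (sfObjects₈qvr d mm (Fin 2 × mm × mm) a (TraceFormCoords.tfCoords mm) hL μ₁ μ₂ α β j j' α' β' j₂ j₂' c35 p
        (wQ8c d mm (Fin 2 × mm × mm) a (TraceFormCoords.tfCoords mm) hd hL hL7 ha hc35 (TraceFormCoords.traceForm_eq_tfCoords_dotProduct mm) μ₁ μ₂ α β j j' α' β' j₂ j₂' p))) ∧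
      N15At (ne2OfRecord₁₁ (sfObjects₈qvr d mm (Fin 2 × mm × mm) a (TraceFormCoords.tfCoords mm) hL μ₁ μ₂ α β j j' α' β' j₂ j₂' c35 p
        (wQ8c d mm (Fin 2 × mm × mm) a (TraceFormCoords.tfCoords mm) hd hL hL7 ha hc35 (TraceFormCoords.traceForm_eq_tfCoords_dotProduct mm) μ₁ μ₂ α β j j' α' β' j₂ j₂' p))) :=
  live_and_n15At_sfObjects₈qvr_wQ8D_tf d mm a hd hL hL7 ha hc35 μ₁ μ₂
    (landauDefectRow_sfqr d mm (Fin 2 × mm × mm) (TraceFormCoords.tfCoords mm) hL hL7 ha hc35) α β j j' α' β' j₂ j₂' p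

end Tf

end Summit.QuantumFields.YangMills.BalabanUVNodes.N15.SiteLayerSf

end
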